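import Literature.Analysis.FluidPDE.KNSSBlowupLimit
import Literature.Analysis.FluidPDE.BoundedWeakGalilean
import Literature.Analysis.FluidPDE.AncientMildWeak
import Literature.Analysis.FluidPDE.KNSSAxisymmetricNoSwirl
import Literature.Analysis.FluidPDE.SolenoidalL2Duality
import HarnessLib

/-!
# Bounded weak Navier–Stokes solutions with a parasitic drift: the weak identity split along
# `u = U + β(t) e`, and limits of such solutions

Analysis/FluidPDE proofs file (theorems only; no definitions, no named facts).  In the class of
bounded weak solutions of Koch–Nadirashvili–Seregin–Šverák (`IsBoundedWeakNSSolutionOn`, Acta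
Math. 203 (2009) = arXiv:0709.3599, §4 (ii)) a solution is, by §4 of that paper, of the form
`u(t, x) = U(t, x) + b(t)` with `U` smooth and `b` merely bounded measurable (the "parasitic"
part, §1 p. 3; in the axisymmetric case `b(t) = β(t) e_z`, proof of Theorem 5.3).  Compactness
arguments run on translates of such a `u` (the "sliding" of Lei–Zhang, J. Funct. Anal. 261 (2011),
proof of Thm. 1.1, and of Lei–Ren–Zhang, arXiv:1902.11229, Lemma 5.1) meet the obstacle that the
drifts `β(t_n + ·)` have no pointwise convergent subsequence.  This file isolates the drift in the
weak identity and passes to the limit through the PRIMITIVES `B_n = ∫ β_n`, which are uniformly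
Lipschitz:

* `integral_weakIntegrand_add_smul_eq` — for a slice `U(t)` (continuous, weakly divergence
  free), a scalar `β` and a divergence-free space–time test field `ψ`, the `x`-integral of the weak
  Navier–Stokes integrand of `U(t) + β e` equals that of `U(t)` plus
  `β ∫ ⟪U(t, x), Dψ(t, x)[e]⟫ dx`: the four pairings of the constant field `e` with `∂ₜψ`,
  `Dψ[U]`, `Δψ`, `Dψ[e]` vanish (zero mean of compactly supported divergence-free fields,
  `integral_inner_const_eq_zero_of_isDivFree`; the weak divergence constraint; integration of an
  exact derivative);
* `IsBoundedWeakNSSolutionOn.integral_add_drift_eq_zero` /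
  `isBoundedWeakNSSolutionOn_add_smul_of_integral` — the weak identity of `U + β(t) e` is
  EQUIVALENT to `∫∫ I[U] + ∫ β(t) g_ψ(t) dt = 0` for all test fields, `g_ψ(t) = ∫ ⟪U(t), Dψ(t)[e]⟫`;
* `isBoundedWeakNSSolutionOn_add_smul_of_tendsto` — **the limit theorem**: if `U_k + β_k(t) e`
  are bounded weak solutions on `ℝⁿ × (A_k, 0)`, `A_k → −∞`, with `U_k` continuous on its slab,
  `‖U_k‖ ≤ M`, weakly divergence-free slices, `|β_k| ≤ C`, `U_k(t, x) → W(t, x)` for `t < 0` with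
  `W` jointly continuous, `‖W‖ ≤ M`, `‖W(t, x) − W(s, x)‖ ≤ L|t − s|`, and the primitives
  `B_k(t) = ∫₀ᵗ β_k` converge pointwise to `B`, then `W + B'(t) e` is a bounded weak solution on
  `ℝⁿ × (−∞, 0)` (`B' = deriv B`, `B` being `C`-Lipschitz): the `U`-part of the split identity
  converges by dominated convergence exactly as in `isBoundedWeakNSSolutionOn_of_tendsto`,
  `∫ β_k (g_k − g) → 0` by dominated convergence in `t` (`g_k(t) → g(t)` by dominated convergence
  in `x`), and `∫ β_k g = −∫ B_k g' → −∫ B g' = ∫ B' g`, integrating by parts twice (Mathlib's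
  `AbsolutelyContinuousOnInterval.integral_mul_deriv_eq_deriv_mul`; `g` is Lipschitz);
* `exists_strictMono_tendsto_primitive` — Arzelà–Ascoli for the primitives (through the bounded,
  uniformly Lipschitz functions `(1 + |t|)⁻¹ B_k(t)` and the tree's
  `exists_strictMono_tendsto_of_lipschitzWith`);
* `IsWeaklyDivFree.add_const` — parasitic constants do not affect the divergence constraint.

The elementary helpers (pairings of constant fields with the derived test fields, the Lipschitz
bound of `g`, primitives and integration by parts) are private.

Everything is proved for any finite-dimensional `E` and any viscosity `ν`.

## References

* G. Koch, N. Nadirashvili, G. Seregin, V. Šverák, *Liouville theorems for the Navier–Stokes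
  equations and applications*, Acta Math. 203 (2009) 83–105 = arXiv:0709.3599: §1 p. 3 (the
  parasitic solutions `b(t)`), §4 (ii) p. 8 (bounded weak solutions), Lemma 6.1 p. 11
  (compactness). [KochNadirashviliSereginSverak2009]
* Z. Lei, Q. S. Zhang, J. Funct. Anal. 261 (2011) 2323–2345 = arXiv:1011.5066, proof of
  Thm. 1.1 (the sliding argument). [LeiZhang2011]
* W. Rudin, *Principles of Mathematical Analysis*, 3rd ed., Thm. 7.23 (diagonal subsequence) and
  Thm. 7.25 (Arzelà–Ascoli). [Rudin1976]
-/

noncomputable section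

open MeasureTheory Set Function Filter Topology TopologicalSpace Metric
open scoped RealInnerProductSpace Laplacian NNReal

namespace Literature.Analysis.FluidPDE

variable {E : Type*} [NormedAddCommGroup E] [InnerProductSpace ℝ E] [FiniteDimensional ℝ E]
  [MeasurableSpace E] [BorelSpace E]

/-! ### Pairings of a constant field with the derived test fields vanish -/

section ConstantPairings

/-- Integrability of the pairing of a bounded a.e. strongly measurable field with a continuous
compactly supported one. [folklore] -/
private theorem integrable_inner_of_norm_le_of_hasCompactSupport_aux {F : Type*} [NormedAddCommGroup F]
    [InnerProductSpace ℝ F] {w G : E → F} (hw : AEStronglyMeasurable w volume) {M : ℝ}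
    (hM : ∀ x, ‖w x‖ ≤ M) (hG : Continuous G) (hGc : HasCompactSupport G) :
    Integrable (fun x => ⟪w x, G x⟫) (volume : Measure E) := by
  refine ((hG.norm.integrable_of_hasCompactSupport hGc.norm).const_mul M).mono' (hw.inner
    hG.aestronglyMeasurable) (Eventually.of_forall fun x => ?_)
  calc ‖⟪w x, G x⟫‖ ≤ ‖w x‖ * ‖G x‖ := norm_inner_le_norm _ _
    _ ≤ M * ‖G x‖ := mul_le_mul_of_nonneg_right (hM x) (norm_nonneg _)

variable {ψ : ℝ → E → E}

/-- `∫ ⟪e, ∂ₜψ(t, x)⟫ dx = 0`: the time derivative of a space–time test field with divergence-free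
slices is a compactly supported divergence-free field, and those have zero mean
(`integral_inner_const_eq_zero_of_isDivFree`). [folklore] -/
private theorem integral_inner_const_timeDeriv_eq_zero (hψ : IsSpaceTimeTestOn (⊤ : Opens (ℝ × E)) ψ)
    (hdiv : ∀ t, VectorCalculus.IsDivFree (ψ t)) (e : E) (t : ℝ) :
    ∫ x, ⟪e, timeDeriv ψ t x⟫ = 0 :=
  integral_inner_const_eq_zero_of_isDivFree e
    ((hψ.timeDeriv_top.contDiff_slice t).of_le (by exact_mod_cast le_top))
    (hψ.timeDeriv_top.hasCompactSupport_slice t) (hψ.isDivFree_timeDeriv hdiv t)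

/-- `∫ ⟪e, Δψ(t, x)⟫ dx = 0`: the Laplacian of a divergence-free test slice is compactly
supported and divergence free. [folklore] -/
private theorem integral_inner_const_laplacian_eq_zero (hψ : IsSpaceTimeTestOn (⊤ : Opens (ℝ × E)) ψ)
    (hdiv : ∀ t, VectorCalculus.IsDivFree (ψ t)) (e : E) (t : ℝ) :
    ∫ x, ⟪e, (Δ (ψ t)) x⟫ = 0 :=
  integral_inner_const_eq_zero_of_isDivFree e
    ((hψ.laplacian_top.contDiff_slice t).of_le (by exact_mod_cast le_top))
    (hψ.laplacian_top.hasCompactSupport_slice t)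
    (isDivFree_laplacian_of_contDiff (contDiff_infty.1 (hψ.contDiff_slice t) 3) (hdiv t))

/-- `∫ ⟪e, Dψ(t, x)[e']⟫ dx = 0`: the integral of an exact derivative of a compactly supported
field (`integral_fderiv_apply_eq_zero`). [folklore] -/
private theorem integral_inner_const_fderiv_const_eq_zero (hψ : IsSpaceTimeTestOn (⊤ : Opens (ℝ × E)) ψ)
    (e e' : E) (t : ℝ) : ∫ x, ⟪e, fderiv ℝ (ψ t) x e'⟫ = 0 := by
  have h := integral_fderiv_apply_eq_zero
    ((hψ.contDiff_slice t).of_le (by exact_mod_cast le_top)) (hψ.hasCompactSupport_slice t) e'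
  have hi : Integrable (fun x => fderiv ℝ (ψ t) x e') (volume : Measure E) :=
    ((hψ.fderiv_top.contDiff_slice t).continuous.clm_apply continuous_const).integrable_of_hasCompactSupport
      ((hψ.fderiv_top.hasCompactSupport_slice t).comp_left (g := fun L : E →L[ℝ] E => L e')
        (by simp))
  rw [integral_inner hi e, h, inner_zero_right]

/-- `∫ ⟪e, Dψ(t, x)[U(x)]⟫ dx = 0` for a weakly divergence-free slice `U`: this is the
divergence constraint tested with the scalar test function `x ↦ ⟪e, ψ(t, x)⟫`. [folklore] -/
private theorem integral_inner_const_fderiv_apply_eq_zero (hψ : IsSpaceTimeTestOn (⊤ : Opens (ℝ × E)) ψ)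
    {U : E → E} (hU : IsWeaklyDivFree U) (e : E) (t : ℝ) :
    ∫ x, ⟪e, fderiv ℝ (ψ t) x (U x)⟫ = 0 := by
  haveI : CompleteSpace E := FiniteDimensional.complete ℝ E
  have hθ : FunctionSpaces.IsTestFunctionOn (⊤ : Opens E) (fun x => ⟪e, ψ t x⟫) :=
    ⟨contDiff_const.inner ℝ (hψ.contDiff_slice t),
      (hψ.hasCompactSupport_slice t).comp_left (g := fun v : E => ⟪e, v⟫) (inner_zero_right e),
      fun _ _ => trivial⟩
  have h0 := hU _ hθ
  have hpt : ∀ x, ⟪U x, gradient (fun x => ⟪e, ψ t x⟫) x⟫ = ⟪e, fderiv ℝ (ψ t) x (U x)⟫ := by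
    intro x
    rw [real_inner_gradient_right]
    rw [fderiv_inner_apply ℝ (differentiableAt_const e)
      ((hψ.contDiff_slice t).differentiable (by simp) x)]
    simp
  simpa only [hpt] using h0

end ConstantPairings

/-! ### The weak integrand of `U + β e`, slice by slice -/

section Slice

variable {ψ : ℝ → E → E}

/-- **The drift splits off the weak integrand, slice by slice.** For a continuous bounded weakly
divergence-free slice `U`, a scalar `β`, a vector `e` and a space–time test field `ψ` with
divergence-free slices, at every time `t`:
`∫ I[U + β e](t, x) dx = ∫ I[U](t, x) dx + β ∫ ⟪U(x), Dψ(t, x)[e]⟫ dx`, where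
`I[w](t, x) = ⟪w, ∂ₜψ⟫ + ⟪w, Dψ[w]⟫ + ν⟪w, Δψ⟫` is the Navier–Stokes weak integrand (the four
pairings of the constant `e` vanish by the lemmas above). [cite: KochNadirashviliSereginSverak2009, §1 p. 3 and §4 (ii) p. 8 (the parasitic part b(t))] -/
theorem integral_weakIntegrand_add_smul_eq (hψ : IsSpaceTimeTestOn (⊤ : Opens (ℝ × E)) ψ)
    (hdiv : ∀ t, VectorCalculus.IsDivFree (ψ t)) {U : E → E} (hUc : Continuous U) {M : ℝ}
    (hUM : ∀ x, ‖U x‖ ≤ M) (hUdiv : IsWeaklyDivFree U) (β ν : ℝ) (e : E) (t : ℝ) :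
    ∫ x, (⟪U x + β • e, timeDeriv ψ t x⟫ + ⟪U x + β • e, fderiv ℝ (ψ t) x (U x + β • e)⟫ +
        ν * ⟪U x + β • e, (Δ (ψ t)) x⟫) =
      (∫ x, (⟪U x, timeDeriv ψ t x⟫ + ⟪U x, fderiv ℝ (ψ t) x (U x)⟫ + ν * ⟪U x, (Δ (ψ t)) x⟫)) +
        β * ∫ x, ⟪U x, fderiv ℝ (ψ t) x e⟫ := by
  -- continuity / compact support of the derived slices
  have c1 : Continuous (timeDeriv ψ t) := (hψ.timeDeriv_top.contDiff_slice t).continuous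
  have s1 : HasCompactSupport (timeDeriv ψ t) := hψ.timeDeriv_top.hasCompactSupport_slice t
  have c2 : Continuous fun x => fderiv ℝ (ψ t) x := (hψ.fderiv_top.contDiff_slice t).continuous
  have s2 : HasCompactSupport fun x => fderiv ℝ (ψ t) x := hψ.fderiv_top.hasCompactSupport_slice t
  have c3 : Continuous (Δ (ψ t)) := (hψ.laplacian_top.contDiff_slice t).continuous
  have s3 : HasCompactSupport (Δ (ψ t)) := hψ.laplacian_top.hasCompactSupport_slice t
  have hUm : AEStronglyMeasurable U volume := hUc.aestronglyMeasurable
  have hem : AEStronglyMeasurable (fun _ : E => e) volume := aestronglyMeasurable_const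
  have heM : ∀ x : E, ‖(fun _ : E => e) x‖ ≤ ‖e‖ := fun _ => le_rfl
  -- compact support of the applied derivative fields
  have s2U : HasCompactSupport fun x => fderiv ℝ (ψ t) x (U x) := by
    refine s2.mono ?_
    intro x hx
    contrapose! hx
    rw [notMem_support] at hx ⊢
    simp [hx]
  have s2e : ∀ v : E, HasCompactSupport fun x => fderiv ℝ (ψ t) x v := fun v =>
    s2.comp_left (g := fun L : E →L[ℝ] E => L v) (by simp)
  have c2U : Continuous fun x => fderiv ℝ (ψ t) x (U x) := c2.clm_apply hUc
  have c2e : ∀ v : E, Continuous fun x => fderiv ℝ (ψ t) x v := fun v => c2.clm_apply continuous_const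
  -- the integrable pieces
  have iU1 : Integrable (fun x => ⟪U x, timeDeriv ψ t x⟫) (volume : Measure E) :=
    integrable_inner_of_norm_le_of_hasCompactSupport_aux hUm hUM c1 s1
  have iU2 : Integrable (fun x => ⟪U x, fderiv ℝ (ψ t) x (U x)⟫) (volume : Measure E) :=
    integrable_inner_of_norm_le_of_hasCompactSupport_aux hUm hUM c2U s2U
  have iU2e : Integrable (fun x => ⟪U x, fderiv ℝ (ψ t) x e⟫) (volume : Measure E) :=
    integrable_inner_of_norm_le_of_hasCompactSupport_aux hUm hUM (c2e e) (s2e e)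
  have iU3 : Integrable (fun x => ⟪U x, (Δ (ψ t)) x⟫) (volume : Measure E) :=
    integrable_inner_of_norm_le_of_hasCompactSupport_aux hUm hUM c3 s3
  have ie1 : Integrable (fun x => ⟪e, timeDeriv ψ t x⟫) (volume : Measure E) :=
    integrable_inner_of_norm_le_of_hasCompactSupport_aux hem heM c1 s1
  have ie2U : Integrable (fun x => ⟪e, fderiv ℝ (ψ t) x (U x)⟫) (volume : Measure E) :=
    integrable_inner_of_norm_le_of_hasCompactSupport_aux hem heM c2U s2U
  have ie2e : Integrable (fun x => ⟪e, fderiv ℝ (ψ t) x e⟫) (volume : Measure E) :=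
    integrable_inner_of_norm_le_of_hasCompactSupport_aux hem heM (c2e e) (s2e e)
  have ie3 : Integrable (fun x => ⟪e, (Δ (ψ t)) x⟫) (volume : Measure E) :=
    integrable_inner_of_norm_le_of_hasCompactSupport_aux hem heM c3 s3
  -- the four vanishing pairings
  have z1 : ∫ x, ⟪e, timeDeriv ψ t x⟫ = 0 := integral_inner_const_timeDeriv_eq_zero hψ hdiv e t
  have z2 : ∫ x, ⟪e, fderiv ℝ (ψ t) x (U x)⟫ = 0 :=
    integral_inner_const_fderiv_apply_eq_zero hψ hUdiv e t
  have z3 : ∫ x, ⟪e, (Δ (ψ t)) x⟫ = 0 := integral_inner_const_laplacian_eq_zero hψ hdiv e t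
  have z4 : ∫ x, ⟪e, fderiv ℝ (ψ t) x e⟫ = 0 := integral_inner_const_fderiv_const_eq_zero hψ e e t
  -- pointwise algebra
  have hpt : ∀ x, ⟪U x + β • e, timeDeriv ψ t x⟫ + ⟪U x + β • e, fderiv ℝ (ψ t) x (U x + β • e)⟫ +
      ν * ⟪U x + β • e, (Δ (ψ t)) x⟫ =
      (⟪U x, timeDeriv ψ t x⟫ + ⟪U x, fderiv ℝ (ψ t) x (U x)⟫ + ν * ⟪U x, (Δ (ψ t)) x⟫) +
        (β * ⟪U x, fderiv ℝ (ψ t) x e⟫ +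
          (β * ⟪e, timeDeriv ψ t x⟫ + β * ⟪e, fderiv ℝ (ψ t) x (U x)⟫ +
            ν * β * ⟪e, (Δ (ψ t)) x⟫ + β * β * ⟪e, fderiv ℝ (ψ t) x e⟫)) := by
    intro x
    simp only [map_add, map_smul, inner_add_left, inner_add_right, inner_smul_left,
      inner_smul_right, RCLike.conj_to_real]
    ring
  simp_rw [hpt]
  -- integrability of the grouped pieces (as lambdas)
  have iP : Integrable (fun x => ⟪U x, timeDeriv ψ t x⟫ + ⟪U x, fderiv ℝ (ψ t) x (U x)⟫ +
      ν * ⟪U x, (Δ (ψ t)) x⟫) (volume : Measure E) := (iU1.add iU2).add (iU3.const_mul ν)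
  have iq : Integrable (fun x => β * ⟪U x, fderiv ℝ (ψ t) x e⟫) (volume : Measure E) :=
    iU2e.const_mul β
  have iab : Integrable (fun x => β * ⟪e, timeDeriv ψ t x⟫ + β * ⟪e, fderiv ℝ (ψ t) x (U x)⟫)
      (volume : Measure E) := (ie1.const_mul β).add (ie2U.const_mul β)
  have iabc : Integrable (fun x => β * ⟪e, timeDeriv ψ t x⟫ + β * ⟪e, fderiv ℝ (ψ t) x (U x)⟫ +
      ν * β * ⟪e, (Δ (ψ t)) x⟫) (volume : Measure E) := iab.add (ie3.const_mul (ν * β))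
  have iR : Integrable (fun x => β * ⟪e, timeDeriv ψ t x⟫ + β * ⟪e, fderiv ℝ (ψ t) x (U x)⟫ +
      ν * β * ⟪e, (Δ (ψ t)) x⟫ + β * β * ⟪e, fderiv ℝ (ψ t) x e⟫) (volume : Measure E) :=
    iabc.add (ie2e.const_mul (β * β))
  have iqR : Integrable (fun x => β * ⟪U x, fderiv ℝ (ψ t) x e⟫ +
      (β * ⟪e, timeDeriv ψ t x⟫ + β * ⟪e, fderiv ℝ (ψ t) x (U x)⟫ +
        ν * β * ⟪e, (Δ (ψ t)) x⟫ + β * β * ⟪e, fderiv ℝ (ψ t) x e⟫)) (volume : Measure E) :=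
    iq.add iR
  have e1 : ∫ x, ((⟪U x, timeDeriv ψ t x⟫ + ⟪U x, fderiv ℝ (ψ t) x (U x)⟫ +
      ν * ⟪U x, (Δ (ψ t)) x⟫) + (β * ⟪U x, fderiv ℝ (ψ t) x e⟫ +
      (β * ⟪e, timeDeriv ψ t x⟫ + β * ⟪e, fderiv ℝ (ψ t) x (U x)⟫ +
        ν * β * ⟪e, (Δ (ψ t)) x⟫ + β * β * ⟪e, fderiv ℝ (ψ t) x e⟫))) =
      (∫ x, (⟪U x, timeDeriv ψ t x⟫ + ⟪U x, fderiv ℝ (ψ t) x (U x)⟫ +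
        ν * ⟪U x, (Δ (ψ t)) x⟫)) + ∫ x, (β * ⟪U x, fderiv ℝ (ψ t) x e⟫ +
      (β * ⟪e, timeDeriv ψ t x⟫ + β * ⟪e, fderiv ℝ (ψ t) x (U x)⟫ +
        ν * β * ⟪e, (Δ (ψ t)) x⟫ + β * β * ⟪e, fderiv ℝ (ψ t) x e⟫)) := integral_add iP iqR
  have e2 : ∫ x, (β * ⟪U x, fderiv ℝ (ψ t) x e⟫ +
      (β * ⟪e, timeDeriv ψ t x⟫ + β * ⟪e, fderiv ℝ (ψ t) x (U x)⟫ +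
        ν * β * ⟪e, (Δ (ψ t)) x⟫ + β * β * ⟪e, fderiv ℝ (ψ t) x e⟫)) =
      (∫ x, β * ⟪U x, fderiv ℝ (ψ t) x e⟫) + ∫ x, (β * ⟪e, timeDeriv ψ t x⟫ +
        β * ⟪e, fderiv ℝ (ψ t) x (U x)⟫ + ν * β * ⟪e, (Δ (ψ t)) x⟫ +
        β * β * ⟪e, fderiv ℝ (ψ t) x e⟫) := integral_add iq iR
  have e3 : ∫ x, (β * ⟪e, timeDeriv ψ t x⟫ + β * ⟪e, fderiv ℝ (ψ t) x (U x)⟫ +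
      ν * β * ⟪e, (Δ (ψ t)) x⟫ + β * β * ⟪e, fderiv ℝ (ψ t) x e⟫) =
      (∫ x, (β * ⟪e, timeDeriv ψ t x⟫ + β * ⟪e, fderiv ℝ (ψ t) x (U x)⟫ +
        ν * β * ⟪e, (Δ (ψ t)) x⟫)) + ∫ x, β * β * ⟪e, fderiv ℝ (ψ t) x e⟫ :=
    integral_add iabc (ie2e.const_mul (β * β))
  have e4 : ∫ x, (β * ⟪e, timeDeriv ψ t x⟫ + β * ⟪e, fderiv ℝ (ψ t) x (U x)⟫ +
      ν * β * ⟪e, (Δ (ψ t)) x⟫) =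
      (∫ x, (β * ⟪e, timeDeriv ψ t x⟫ + β * ⟪e, fderiv ℝ (ψ t) x (U x)⟫)) +
        ∫ x, ν * β * ⟪e, (Δ (ψ t)) x⟫ := integral_add iab (ie3.const_mul (ν * β))
  have e5 : ∫ x, (β * ⟪e, timeDeriv ψ t x⟫ + β * ⟪e, fderiv ℝ (ψ t) x (U x)⟫) =
      (∫ x, β * ⟪e, timeDeriv ψ t x⟫) + ∫ x, β * ⟪e, fderiv ℝ (ψ t) x (U x)⟫ :=
    integral_add (ie1.const_mul β) (ie2U.const_mul β)
  rw [e1, e2, e3, e4, e5, integral_const_mul, integral_const_mul, integral_const_mul,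
    integral_const_mul, integral_const_mul, z1, z2, z3, z4]
  ring

end Slice

/-! ### The weak identity of `U + β(t) e` on a slab -/

section Slab

variable {I : Set ℝ} {hI : IsOpen I} {ν M C : ℝ} {U : ℝ → E → E} {β : ℝ → ℝ} {e : E}
  {ψ : ℝ → E → E}

/-- **The weak identity of `U + β(t) e` splits off the drift.** Let `U` be continuous on the slab
`I × E` with `‖U‖ ≤ M` and weakly divergence-free slices, `β` measurable with `|β| ≤ C`, and `ψ`
a space–time test field on the slab with divergence-free slices. Then
`∫_I ∫ I[U + β e] = ∫_I ∫ I[U] + ∫_I β(t) (∫ ⟪U(t, x), Dψ(t, x)[e]⟫ dx) dt`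
(slice by slice `integral_weakIntegrand_add_smul_eq`; the two time integrands are integrable on
`I` as slice integrals of integrable functions on `I × E`). [cite: KochNadirashviliSereginSverak2009, §1 p. 3 and §4 (ii) p. 8 (the parasitic part b(t))] -/
theorem setIntegral_weakIntegrand_add_smul_eq (hUc : ContinuousOn (uncurry U) (I ×ˢ univ))
    (hUM : ∀ t ∈ I, ∀ x, ‖U t x‖ ≤ M) (hUdiv : ∀ t ∈ I, IsWeaklyDivFree (U t))
    (hβm : Measurable β) (hβC : ∀ t, |β t| ≤ C)
    (hψ : IsSpaceTimeTestOn (slab E I hI) ψ) (hψdiv : ∀ t, VectorCalculus.IsDivFree (ψ t)) :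
    ∫ t in I, ∫ x, (⟪U t x + β t • e, timeDeriv ψ t x⟫ +
        ⟪U t x + β t • e, convect (fun y => U t y + β t • e) (ψ t) x⟫ +
        ν * ⟪U t x + β t • e, (Δ (ψ t)) x⟫) =
      (∫ t in I, ∫ x, (⟪U t x, timeDeriv ψ t x⟫ + ⟪U t x, convect (U t) (ψ t) x⟫ +
        ν * ⟪U t x, (Δ (ψ t)) x⟫)) +
      ∫ t in I, β t * ∫ x, ⟪U t x, fderiv ℝ (ψ t) x e⟫ := by
  have hψ' : IsSpaceTimeTestOn (⊤ : Opens (ℝ × E)) ψ := hψ.mono le_top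
  have hUct : ∀ t ∈ I, Continuous (U t) := fun t ht =>
    hUc.comp_continuous (f := fun x : E => (t, x)) (by fun_prop) fun x => ⟨ht, mem_univ _⟩
  -- slice by slice
  have hslice : ∀ t ∈ I, ∫ x, (⟪U t x + β t • e, timeDeriv ψ t x⟫ +
        ⟪U t x + β t • e, convect (fun y => U t y + β t • e) (ψ t) x⟫ +
        ν * ⟪U t x + β t • e, (Δ (ψ t)) x⟫) =
      (∫ x, (⟪U t x, timeDeriv ψ t x⟫ + ⟪U t x, convect (U t) (ψ t) x⟫ +
        ν * ⟪U t x, (Δ (ψ t)) x⟫)) + β t * ∫ x, ⟪U t x, fderiv ℝ (ψ t) x e⟫ := by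
    intro t ht
    simp only [convect_apply]
    exact integral_weakIntegrand_add_smul_eq hψ' hψdiv (hUct t ht) (hUM t ht) (hUdiv t ht)
      (β t) ν e t
  rw [setIntegral_congr_fun hI.measurableSet hslice]
  -- integrability in `t` of the two pieces, through the product `I × E`
  set π : Measure (ℝ × E) := ((volume : Measure ℝ).restrict I).prod volume with hπ
  have hπ' : π = (volume : Measure (ℝ × E)).restrict (I ×ˢ univ) := by
    rw [hπ, Measure.restrict_prod_eq_prod_univ, ← Measure.volume_eq_prod]
  have hπmem : ∀ᵐ z ∂π, z ∈ I ×ˢ (univ : Set E) := by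
    rw [hπ']; exact ae_restrict_mem (hI.measurableSet.prod MeasurableSet.univ)
  have hUmeas : AEStronglyMeasurable (uncurry U) π := by
    rw [hπ']; exact hUc.aestronglyMeasurable (hI.measurableSet.prod MeasurableSet.univ)
  have hc1 : Continuous (uncurry (timeDeriv ψ)) := hψ'.timeDeriv_top.continuous_uncurry
  have hc2 : Continuous (uncurry fun t x => fderiv ℝ (ψ t) x) := hψ'.fderiv_top.continuous_uncurry
  have hc3 : Continuous (uncurry fun t => Δ (ψ t)) := hψ'.laplacian_top.continuous_uncurry
  have hs1 := hψ'.timeDeriv_top.hasCompactSupport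
  have hs2 := hψ'.fderiv_top.hasCompactSupport
  have hs3 := hψ'.laplacian_top.hasCompactSupport
  have hM0 : ∀ t ∈ I, 0 ≤ M := fun t ht => (norm_nonneg _).trans (hUM t ht 0)
  -- the `U`-part
  set G : ℝ × E → ℝ := fun z => ⟪U z.1 z.2, timeDeriv ψ z.1 z.2⟫ +
    ⟪U z.1 z.2, convect (U z.1) (ψ z.1) z.2⟫ + ν * ⟪U z.1 z.2, (Δ (ψ z.1)) z.2⟫ with hG
  set bound : ℝ × E → ℝ := fun z => M * ‖timeDeriv ψ z.1 z.2‖ +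
    M * M * ‖fderiv ℝ (ψ z.1) z.2‖ + |ν| * M * ‖(Δ (ψ z.1)) z.2‖ with hbound
  have hbound_int : Integrable bound π := by
    rw [hπ']
    refine Integrable.restrict ?_
    refine ((Integrable.const_mul ?_ M).add (Integrable.const_mul ?_ (M * M))).add
      (Integrable.const_mul ?_ (|ν| * M))
    · exact hc1.norm.integrable_of_hasCompactSupport hs1.norm
    · exact hc2.norm.integrable_of_hasCompactSupport hs2.norm
    · exact hc3.norm.integrable_of_hasCompactSupport hs3.norm
  have hGmeas : AEStronglyMeasurable G π := by
    have happ := (isBoundedBilinearMap_apply (𝕜 := ℝ) (E := E) (F := E)).continuous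
    have h2 : AEStronglyMeasurable (fun z : ℝ × E => fderiv ℝ (ψ z.1) z.2 (U z.1 z.2)) π :=
      happ.comp_aestronglyMeasurable (hc2.aestronglyMeasurable.prodMk hUmeas)
    simp only [hG, convect_apply]
    exact ((hUmeas.inner hc1.aestronglyMeasurable).add (hUmeas.inner h2)).add
      ((hUmeas.inner hc3.aestronglyMeasurable).const_mul ν)
  have hGbound : ∀ᵐ z ∂π, ‖G z‖ ≤ bound z := by
    filter_upwards [hπmem] with z hz
    have hw : ‖U z.1 z.2‖ ≤ M := hUM z.1 hz.1 z.2
    have hM0' : 0 ≤ M := hM0 z.1 hz.1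
    simp only [hG, hbound, Real.norm_eq_abs, convect_apply]
    have e1 : |⟪U z.1 z.2, timeDeriv ψ z.1 z.2⟫| ≤ M * ‖timeDeriv ψ z.1 z.2‖ :=
      (abs_real_inner_le_norm _ _).trans (mul_le_mul_of_nonneg_right hw (norm_nonneg _))
    have e2 : |⟪U z.1 z.2, fderiv ℝ (ψ z.1) z.2 (U z.1 z.2)⟫| ≤ M * M * ‖fderiv ℝ (ψ z.1) z.2‖ := by
      calc |⟪U z.1 z.2, fderiv ℝ (ψ z.1) z.2 (U z.1 z.2)⟫|
          ≤ ‖U z.1 z.2‖ * ‖fderiv ℝ (ψ z.1) z.2 (U z.1 z.2)‖ := abs_real_inner_le_norm _ _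
        _ ≤ ‖U z.1 z.2‖ * (‖fderiv ℝ (ψ z.1) z.2‖ * ‖U z.1 z.2‖) := by
            gcongr; exact ContinuousLinearMap.le_opNorm _ _
        _ ≤ M * (‖fderiv ℝ (ψ z.1) z.2‖ * M) := by gcongr
        _ = M * M * ‖fderiv ℝ (ψ z.1) z.2‖ := by ring
    have e3 : |ν * ⟪U z.1 z.2, (Δ (ψ z.1)) z.2⟫| ≤ |ν| * M * ‖(Δ (ψ z.1)) z.2‖ := by
      rw [abs_mul, mul_assoc]
      exact mul_le_mul_of_nonneg_left ((abs_real_inner_le_norm _ _).trans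
        (mul_le_mul_of_nonneg_right hw (norm_nonneg _))) (abs_nonneg ν)
    calc |⟪U z.1 z.2, timeDeriv ψ z.1 z.2⟫ + ⟪U z.1 z.2, fderiv ℝ (ψ z.1) z.2 (U z.1 z.2)⟫ +
          ν * ⟪U z.1 z.2, (Δ (ψ z.1)) z.2⟫|
        ≤ |⟪U z.1 z.2, timeDeriv ψ z.1 z.2⟫| + |⟪U z.1 z.2, fderiv ℝ (ψ z.1) z.2 (U z.1 z.2)⟫| +
          |ν * ⟪U z.1 z.2, (Δ (ψ z.1)) z.2⟫| :=
          (abs_add_le _ _).trans (add_le_add (abs_add_le _ _) le_rfl)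
      _ ≤ _ := add_le_add (add_le_add e1 e2) e3
  have hGint : Integrable G π := hbound_int.mono' hGmeas hGbound
  have hI1 : Integrable (fun t => ∫ x, G (t, x)) ((volume : Measure ℝ).restrict I) :=
    hGint.integral_prod_left
  -- the drift part
  set H : ℝ × E → ℝ := fun z => β z.1 * ⟪U z.1 z.2, fderiv ℝ (ψ z.1) z.2 e⟫ with hH
  have hHmeas : AEStronglyMeasurable H π := by
    have hβ' : AEStronglyMeasurable (fun z : ℝ × E => β z.1) π :=
      (hβm.comp measurable_fst).aestronglyMeasurable
    have h2 : AEStronglyMeasurable (fun z : ℝ × E => fderiv ℝ (ψ z.1) z.2 e) π :=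
      (hc2.clm_apply continuous_const).aestronglyMeasurable
    exact hβ'.mul (hUmeas.inner h2)
  have hHbound : ∀ᵐ z ∂π, ‖H z‖ ≤ C * (M * ‖e‖) * ‖fderiv ℝ (ψ z.1) z.2‖ := by
    filter_upwards [hπmem] with z hz
    have hw : ‖U z.1 z.2‖ ≤ M := hUM z.1 hz.1 z.2
    rw [hH, norm_mul, Real.norm_eq_abs]
    have h1 : ‖⟪U z.1 z.2, fderiv ℝ (ψ z.1) z.2 e⟫‖ ≤ M * ‖e‖ * ‖fderiv ℝ (ψ z.1) z.2‖ := by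
      calc ‖⟪U z.1 z.2, fderiv ℝ (ψ z.1) z.2 e⟫‖ ≤ ‖U z.1 z.2‖ * ‖fderiv ℝ (ψ z.1) z.2 e‖ :=
            norm_inner_le_norm _ _
        _ ≤ M * (‖fderiv ℝ (ψ z.1) z.2‖ * ‖e‖) := by
            gcongr
            · exact (hM0 z.1 hz.1)
            · exact ContinuousLinearMap.le_opNorm _ _
        _ = M * ‖e‖ * ‖fderiv ℝ (ψ z.1) z.2‖ := by ring
    have hC0 : 0 ≤ C := (abs_nonneg _).trans (hβC z.1)
    calc |β z.1| * ‖⟪U z.1 z.2, fderiv ℝ (ψ z.1) z.2 e⟫‖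
        ≤ C * (M * ‖e‖ * ‖fderiv ℝ (ψ z.1) z.2‖) :=
          mul_le_mul (hβC z.1) h1 (norm_nonneg _) hC0
      _ = C * (M * ‖e‖) * ‖fderiv ℝ (ψ z.1) z.2‖ := by ring
  have hHint : Integrable H π := by
    refine Integrable.mono' ?_ hHmeas hHbound
    rw [hπ']
    exact ((hc2.norm.integrable_of_hasCompactSupport hs2.norm).const_mul _).restrict
  have hI2 : Integrable (fun t => ∫ x, H (t, x)) ((volume : Measure ℝ).restrict I) :=
    hHint.integral_prod_left
  have hI2' : Integrable (fun t => β t * ∫ x, ⟪U t x, fderiv ℝ (ψ t) x e⟫)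
      ((volume : Measure ℝ).restrict I) := by
    refine hI2.congr (Eventually.of_forall fun t => ?_)
    simp only [hH]
    exact integral_const_mul _ _
  simp only [hG] at hI1
  exact integral_add hI1 hI2'

/-- **Forward direction.** If `U + β(t) e` is a bounded weak solution on `ℝⁿ × I`, with `U`
continuous and bounded on the slab, weakly divergence-free slices, and `β` bounded measurable,
then for every space–time test field `ψ` on the slab with divergence-free slices
`∫_I ∫ I[U] + ∫_I β(t) ∫ ⟪U(t), Dψ(t)[e]⟫ = 0`. [cite: KochNadirashviliSereginSverak2009, §4 (ii) p. 8 with §1 p. 3] -/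
theorem IsBoundedWeakNSSolutionOn.integral_add_drift_eq_zero
    (h : IsBoundedWeakNSSolutionOn I hI ν (fun t x => U t x + β t • e))
    (hUc : ContinuousOn (uncurry U) (I ×ˢ univ))
    (hUM : ∀ t ∈ I, ∀ x, ‖U t x‖ ≤ M) (hUdiv : ∀ t ∈ I, IsWeaklyDivFree (U t))
    (hβm : Measurable β) (hβC : ∀ t, |β t| ≤ C)
    (hψ : IsSpaceTimeTestOn (slab E I hI) ψ) (hψdiv : ∀ t, VectorCalculus.IsDivFree (ψ t)) :
    (∫ t in I, ∫ x, (⟪U t x, timeDeriv ψ t x⟫ + ⟪U t x, convect (U t) (ψ t) x⟫ +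
        ν * ⟪U t x, (Δ (ψ t)) x⟫)) +
      ∫ t in I, β t * ∫ x, ⟪U t x, fderiv ℝ (ψ t) x e⟫ = 0 := by
  rw [← setIntegral_weakIntegrand_add_smul_eq hUc hUM hUdiv hβm hβC hψ hψdiv]
  exact h.integral_eq_zero hψ hψdiv

/-- Adding a constant preserves weak divergence-freeness (constants annihilate gradients of test
functions; if `⟪v, ∇θ⟫` is not integrable neither is `⟪v + c, ∇θ⟫`, and both integrals are
Mathlib's junk `0`); in particular KNSS's parasitic solutions `U + b(t)` have weakly
divergence-free slices. [cite: KochNadirashviliSereginSverak2009, §1 p. 3 (the solutions u(x,t) = b(t)) and §4 (ii) p. 8] -/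
theorem IsWeaklyDivFree.add_const {v : E → E} (hv : IsWeaklyDivFree v) (c : E) :
    IsWeaklyDivFree (fun x => v x + c) := by
  haveI : CompleteSpace E := FiniteDimensional.complete ℝ E
  intro θ hθ
  have hc : ∫ x, ⟪c, gradient θ x⟫ = (0 : ℝ) :=
    VectorCalculus.IsDivFree.isWeaklyDivFree_holds (u := fun _ : E => c)
      (fun x => by simp [VectorCalculus.divergence]) contDiff_const θ hθ
  have hgc : Continuous (gradient θ) :=
    (InnerProductSpace.toDual ℝ E).symm.continuous.comp (hθ.contDiff.continuous_fderiv (by simp))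
  have hgs : HasCompactSupport (gradient θ) :=
    (hθ.hasCompactSupport.fderiv (𝕜 := ℝ)).comp_left (g := (InnerProductSpace.toDual ℝ E).symm)
      (map_zero _)
  have hci : Integrable (fun x => ⟪c, gradient θ x⟫) (volume : Measure E) :=
    (hgc.integrable_of_hasCompactSupport hgs).const_inner c
  have hpt : (fun x => ⟪v x + c, gradient θ x⟫) =
      fun x => ⟪v x, gradient θ x⟫ + ⟪c, gradient θ x⟫ := by
    funext x
    rw [inner_add_left]
  rw [hpt]
  by_cases hi : Integrable (fun x => ⟪v x, gradient θ x⟫) (volume : Measure E)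
  · rw [integral_add hi hci, hv θ hθ, hc, add_zero]
  · have hni : ¬ Integrable (fun x => ⟪v x, gradient θ x⟫ + ⟪c, gradient θ x⟫)
        (volume : Measure E) := by
      intro h
      apply hi
      simpa [Pi.sub_def] using h.sub hci
    exact integral_undef hni

/-- **Backward direction.** If `U` is continuous on the slab `I × E`, bounded, with weakly
divergence-free slices, `β` is bounded measurable, and
`∫_I ∫ I[U] + ∫_I β(t) ∫ ⟪U(t), Dψ(t)[e]⟫ = 0` for every space–time test field `ψ` on the slab
with divergence-free slices, then `U + β(t) e` is a bounded weak solution on `ℝⁿ × I`. [cite: KochNadirashviliSereginSverak2009, §4 (ii) p. 8 with §1 p. 3] -/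
theorem isBoundedWeakNSSolutionOn_add_smul_of_integral (hUc : ContinuousOn (uncurry U) (I ×ˢ univ))
    (hUM : ∀ t ∈ I, ∀ x, ‖U t x‖ ≤ M) (hUdiv : ∀ t ∈ I, IsWeaklyDivFree (U t))
    (hβm : Measurable β) (hβC : ∀ t, |β t| ≤ C)
    (hid : ∀ ψ : ℝ → E → E, IsSpaceTimeTestOn (slab E I hI) ψ →
      (∀ t, VectorCalculus.IsDivFree (ψ t)) →
      (∫ t in I, ∫ x, (⟪U t x, timeDeriv ψ t x⟫ + ⟪U t x, convect (U t) (ψ t) x⟫ +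
          ν * ⟪U t x, (Δ (ψ t)) x⟫)) +
        ∫ t in I, β t * ∫ x, ⟪U t x, fderiv ℝ (ψ t) x e⟫ = 0) :
    IsBoundedWeakNSSolutionOn I hI ν (fun t x => U t x + β t • e) := by
  refine ⟨?_, ?_, ?_, fun ψ hψ hψdiv => ?_⟩
  · -- measurability on the slab
    have h1 : AEStronglyMeasurable (uncurry U) (volume.restrict (I ×ˢ univ)) :=
      hUc.aestronglyMeasurable (hI.measurableSet.prod MeasurableSet.univ)
    have h2 : AEStronglyMeasurable (fun z : ℝ × E => β z.1 • e) (volume.restrict (I ×ˢ univ)) :=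
      ((hβm.comp measurable_fst).aestronglyMeasurable).smul aestronglyMeasurable_const
    exact h1.add h2
  · refine ⟨M + C * ‖e‖, fun t ht x => ?_⟩
    calc ‖U t x + β t • e‖ ≤ ‖U t x‖ + ‖β t • e‖ := norm_add_le _ _
      _ ≤ M + C * ‖e‖ := by
          rw [norm_smul, Real.norm_eq_abs]
          exact add_le_add (hUM t ht x) (mul_le_mul_of_nonneg_right (hβC t) (norm_nonneg _))
  · exact (ae_restrict_iff' hI.measurableSet).2
      (Eventually.of_forall fun t ht => (hUdiv t ht).add_const _)
  · rw [setIntegral_weakIntegrand_add_smul_eq hUc hUM hUdiv hβm hβC hψ hψdiv]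
    exact hid ψ hψ hψdiv

end Slab

/-! ### The drift pairing `g(t) = ∫ ⟪W(t, x), Φ(t, x)⟫ dx` is Lipschitz -/

section Pairing

/-- **The pairing of a time-Lipschitz bounded field with a space–time test field is Lipschitz in
time.** If `W` is jointly continuous with `‖W‖ ≤ M` and `‖W(t, x) − W(s, x)‖ ≤ L|t − s|`, and
`Φ` is a space–time test field, then `g(t) = ∫ ⟪W(t, x), Φ(t, x)⟫ dx` satisfies
`|g(t) − g(s)| ≤ L_g |t − s|` for some `L_g ≥ 0` (split `W(t)Φ(t) − W(s)Φ(s)`; `Φ(·, x)` is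
`S`-Lipschitz uniformly in `x`, `S = sup ‖∂ₜΦ‖`, and everything is supported over the compact
projection `K` of the support of `Φ`). [folklore] -/
private theorem exists_lipschitz_integral_inner_of_test {W Φ : ℝ → E → E} (hW : Continuous (uncurry W))
    {M L : ℝ} (hWM : ∀ t x, ‖W t x‖ ≤ M) (hWL : ∀ x s t, ‖W t x - W s x‖ ≤ L * |t - s|)
    (hΦ : IsSpaceTimeTestOn (⊤ : Opens (ℝ × E)) Φ) :
    ∃ Lg : ℝ≥0, LipschitzWith Lg (fun t => ∫ x, ⟪W t x, Φ t x⟫) := by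
  have hM0 : 0 ≤ M := (norm_nonneg _).trans (hWM 0 0)
  have hL0 : 0 ≤ L := by
    have h := hWL 0 0 1
    have h1 : (0 : ℝ) ≤ L * |1 - 0| := (norm_nonneg _).trans h
    simpa using h1
  -- sup bounds of `Φ` and `∂ₜΦ`
  obtain ⟨S₀, hS₀⟩ := hΦ.continuous_uncurry.bounded_above_of_compact_support hΦ.hasCompactSupport
  obtain ⟨S₁, hS₁⟩ := hΦ.timeDeriv_top.continuous_uncurry.bounded_above_of_compact_support
    hΦ.timeDeriv_top.hasCompactSupport
  have hS₀' : ∀ t x, ‖Φ t x‖ ≤ S₀ := fun t x => hS₀ (t, x)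
  have hS₁' : ∀ t x, ‖timeDeriv Φ t x‖ ≤ S₁ := fun t x => hS₁ (t, x)
  have hS00 : 0 ≤ S₀ := (norm_nonneg _).trans (hS₀' 0 0)
  have hS10 : 0 ≤ S₁ := (norm_nonneg _).trans (hS₁' 0 0)
  -- the compact spatial projection of the support
  set K : Set E := Prod.snd '' tsupport (uncurry Φ) with hK
  have hKc : IsCompact K := hΦ.hasCompactSupport.image continuous_snd
  have hKm : MeasurableSet K := hKc.measurableSet
  have hKfin : volume K < ⊤ := hKc.measure_lt_top
  have hΦK : ∀ t x, x ∉ K → Φ t x = 0 := by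
    intro t x hx
    have : (t, x) ∉ tsupport (uncurry Φ) := fun h => hx ⟨(t, x), h, rfl⟩
    have h0 : uncurry Φ (t, x) = 0 := image_eq_zero_of_notMem_tsupport this
    exact h0
  -- `Φ(·, x)` is `S₁`-Lipschitz
  have hΦlip : ∀ x s t, ‖Φ t x - Φ s x‖ ≤ S₁ * |t - s| := by
    intro x s t
    have h := convex_univ.norm_image_sub_le_of_norm_deriv_le (f := fun τ => Φ τ x)
      (fun τ _ => (hΦ.hasDerivAt_time τ x).differentiableAt)
      (fun τ _ => by rw [(hΦ.hasDerivAt_time τ x).deriv]; exact hS₁' τ x)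
      (mem_univ s) (mem_univ t)
    simpa [Real.norm_eq_abs] using h
  -- pointwise bound of the difference of integrands by an indicator
  set c : ℝ → ℝ → ℝ := fun s t => (L * S₀ + M * S₁) * |t - s| with hc
  have hpt : ∀ s t x, ‖⟪W t x, Φ t x⟫ - ⟪W s x, Φ s x⟫‖ ≤ K.indicator (fun _ => c s t) x := by
    intro s t x
    by_cases hx : x ∈ K
    · rw [indicator_of_mem hx]
      have e1 : ⟪W t x, Φ t x⟫ - ⟪W s x, Φ s x⟫ =
          ⟪W t x - W s x, Φ t x⟫ + ⟪W s x, Φ t x - Φ s x⟫ := by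
        rw [inner_sub_left, inner_sub_right]; ring
      rw [e1]
      calc ‖⟪W t x - W s x, Φ t x⟫ + ⟪W s x, Φ t x - Φ s x⟫‖
          ≤ ‖⟪W t x - W s x, Φ t x⟫‖ + ‖⟪W s x, Φ t x - Φ s x⟫‖ := norm_add_le _ _
        _ ≤ ‖W t x - W s x‖ * ‖Φ t x‖ + ‖W s x‖ * ‖Φ t x - Φ s x‖ :=
            add_le_add (norm_inner_le_norm _ _) (norm_inner_le_norm _ _)
        _ ≤ L * |t - s| * S₀ + M * (S₁ * |t - s|) :=
            add_le_add (mul_le_mul (hWL x s t) (hS₀' t x) (norm_nonneg _)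
              (mul_nonneg hL0 (abs_nonneg _)))
              (mul_le_mul (hWM s x) (hΦlip x s t) (norm_nonneg _) hM0)
        _ = c s t := by simp only [hc]; ring
    · rw [indicator_of_notMem hx, hΦK t x hx, hΦK s x hx]
      simp
  -- integrability of the slices
  have hint : ∀ t, Integrable (fun x => ⟪W t x, Φ t x⟫) (volume : Measure E) := fun t =>
    integrable_inner_of_norm_le_of_hasCompactSupport_aux
      (hW.comp (Continuous.prodMk_right t)).aestronglyMeasurable (fun x => hWM t x)
      (hΦ.contDiff_slice t).continuous (hΦ.hasCompactSupport_slice t)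
  refine ⟨⟨(L * S₀ + M * S₁) * (volume K).toReal, by positivity⟩,
    LipschitzWith.of_dist_le_mul fun t s => ?_⟩
  rw [Real.dist_eq, Real.dist_eq, ← integral_sub (hint t) (hint s)]
  calc |∫ x, (⟪W t x, Φ t x⟫ - ⟪W s x, Φ s x⟫)|
      ≤ ∫ x, ‖⟪W t x, Φ t x⟫ - ⟪W s x, Φ s x⟫‖ := by
        rw [← Real.norm_eq_abs]; exact norm_integral_le_integral_norm _
    _ ≤ ∫ x, K.indicator (fun _ => c s t) x :=
        integral_mono ((hint t).sub (hint s)).norm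
          ((integrable_indicator_iff hKm).2 (integrableOn_const hKfin.ne)) (hpt s t)
    _ = (volume K).toReal * c s t := by
        rw [integral_indicator_const _ hKm, smul_eq_mul, Measure.real]
    _ = ↑(⟨(L * S₀ + M * S₁) * (volume K).toReal, by positivity⟩ : ℝ≥0) * |t - s| := by
        simp only [hc]; ring

end Pairing

/-! ### Primitives of bounded drifts -/

section Primitive

variable {β : ℕ → ℝ → ℝ} {C : ℝ}

/-- A measurable real function with `|b| ≤ C` is locally integrable. [folklore] -/
private theorem locallyIntegrable_of_abs_le_aux {b : ℝ → ℝ} (hbm : Measurable b) (hbC : ∀ t, |b t| ≤ C) :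
    LocallyIntegrable b volume :=
  (memLp_top_of_bound hbm.aestronglyMeasurable C
    (Eventually.of_forall fun t => (Real.norm_eq_abs _).le.trans (hbC t))).locallyIntegrable le_top

/-- A measurable real function with `|b| ≤ C` is interval integrable. [folklore] -/
private theorem intervalIntegrable_of_abs_le_aux {b : ℝ → ℝ} (hbm : Measurable b) (hbC : ∀ t, |b t| ≤ C)
    (x y : ℝ) : IntervalIntegrable b volume x y :=
  ((locallyIntegrable_of_abs_le_aux hbm hbC).integrableOn_isCompact isCompact_uIcc).intervalIntegrable

/-- The primitive `t ↦ ∫₀ᵗ β` of a measurable function with `|β| ≤ C` is `C`-Lipschitz. [folklore] -/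
private theorem lipschitzWith_primitive {b : ℝ → ℝ} (hbm : Measurable b) (hbC : ∀ t, |b t| ≤ C) :
    LipschitzWith ⟨C, (abs_nonneg _).trans (hbC 0)⟩ (fun t => ∫ s in (0 : ℝ)..t, b s) := by
  have hbi : ∀ x y : ℝ, IntervalIntegrable b volume x y := intervalIntegrable_of_abs_le_aux hbm hbC
  refine LipschitzWith.of_dist_le_mul fun t s => ?_
  rw [Real.dist_eq, Real.dist_eq, intervalIntegral.integral_interval_sub_left (hbi 0 t) (hbi 0 s)]
  change _ ≤ C * |t - s|
  calc |∫ τ in s..t, b τ| = ‖∫ τ in s..t, b τ‖ := (Real.norm_eq_abs _).symm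
    _ ≤ C * |t - s| := intervalIntegral.norm_integral_le_of_norm_le_const fun τ _ =>
        (Real.norm_eq_abs _).le.trans (hbC τ)

/-- The a.e. derivative of the primitive is the integrand (Lebesgue's differentiation theorem):
`deriv (∫₀ β) = β` a.e. [folklore] -/
private theorem deriv_primitive_ae_eq {b : ℝ → ℝ} (hbm : Measurable b) (hbC : ∀ t, |b t| ≤ C) :
    ∀ᵐ t, deriv (fun t => ∫ s in (0 : ℝ)..t, b s) t = b t := by
  filter_upwards [LocallyIntegrable.ae_hasDerivAt_integral (locallyIntegrable_of_abs_le_aux hbm hbC)]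
    with t ht
  exact (ht 0).deriv

/-- **Integration by parts against a primitive.** For `b` measurable with `|b| ≤ C`,
`B = ∫₀ b`, and a Lipschitz `g` vanishing at `a₀` and `b₁` (`a₀ ≤ b₁`):
`∫_{a₀}^{b₁} b g = −∫_{a₀}^{b₁} B g'` (Mathlib's integration by parts for absolutely continuous
functions, `deriv B = b` a.e.). [folklore] -/
private theorem integral_mul_eq_neg_integral_primitive_mul_deriv {b : ℝ → ℝ} (hbm : Measurable b)
    (hbC : ∀ t, |b t| ≤ C) {g : ℝ → ℝ} {Lg : ℝ≥0} (hg : LipschitzWith Lg g) {a₀ b₁ : ℝ}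
    (hga : g a₀ = 0) (hgb : g b₁ = 0) :
    ∫ t in a₀..b₁, b t * g t =
      -∫ t in a₀..b₁, (∫ s in (0 : ℝ)..t, b s) * deriv g t := by
  have hBac : AbsolutelyContinuousOnInterval (fun t => ∫ s in (0 : ℝ)..t, b s) a₀ b₁ :=
    ((lipschitzWith_primitive hbm hbC).lipschitzOnWith (s := uIcc a₀ b₁)).absolutelyContinuousOnInterval
  have hgac : AbsolutelyContinuousOnInterval g a₀ b₁ :=
    (hg.lipschitzOnWith (s := uIcc a₀ b₁)).absolutelyContinuousOnInterval
  have hibp := hBac.integral_mul_deriv_eq_deriv_mul hgac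
  rw [hga, hgb, mul_zero, mul_zero, sub_self, zero_sub] at hibp
  have hcongr : ∫ t in a₀..b₁, deriv (fun t => ∫ s in (0 : ℝ)..t, b s) t * g t =
      ∫ t in a₀..b₁, b t * g t := by
    refine intervalIntegral.integral_congr_ae ?_
    filter_upwards [deriv_primitive_ae_eq hbm hbC] with t ht _
    rw [ht]
  rw [← hcongr, hibp, neg_neg]

/-- **Limits of primitives.** If `|β_k| ≤ C` and the primitives `B_k = ∫₀ β_k` converge pointwise
to `B`, then `B` is `C`-Lipschitz, `|B'| ≤ C`, and for every Lipschitz `g` vanishing at the ends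
of `[a₀, b₁]`, `∫_{a₀}^{b₁} β_k g → ∫_{a₀}^{b₁} B' g` (`B' = deriv B`): integrate by parts,
pass to the limit in `∫ B_k g'` by dominated convergence, and integrate by parts back. [folklore] -/
private theorem tendsto_integral_mul_of_tendsto_primitive (hβm : ∀ k, Measurable (β k))
    (hβC : ∀ k t, |β k t| ≤ C) {B : ℝ → ℝ}
    (hB : ∀ t, Tendsto (fun k => ∫ s in (0 : ℝ)..t, β k s) atTop (𝓝 (B t)))
    {g : ℝ → ℝ} {Lg : ℝ≥0} (hg : LipschitzWith Lg g) {a₀ b₁ : ℝ} (hab : a₀ ≤ b₁)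
    (hga : g a₀ = 0) (hgb : g b₁ = 0) :
    Tendsto (fun k => ∫ t in a₀..b₁, β k t * g t) atTop
      (𝓝 (∫ t in a₀..b₁, deriv B t * g t)) := by
  have hC0 : 0 ≤ C := (abs_nonneg _).trans (hβC 0 0)
  -- `B` is `C`-Lipschitz
  have hBk : ∀ k, LipschitzWith ⟨C, hC0⟩ (fun t => ∫ s in (0 : ℝ)..t, β k s) := fun k =>
    lipschitzWith_primitive (hβm k) (hβC k)
  have hBlip : LipschitzWith ⟨C, hC0⟩ B := by
    refine LipschitzWith.of_dist_le_mul fun t s => ?_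
    refine le_of_tendsto ((hB t).dist (hB s)) (Eventually.of_forall fun k => ?_)
    exact (hBk k).dist_le_mul t s
  have hB0 : B 0 = 0 := by
    refine tendsto_nhds_unique (hB 0) ?_
    simp
  have hBac : AbsolutelyContinuousOnInterval B a₀ b₁ :=
    (hBlip.lipschitzOnWith (s := uIcc a₀ b₁)).absolutelyContinuousOnInterval
  have hgac : AbsolutelyContinuousOnInterval g a₀ b₁ :=
    (hg.lipschitzOnWith (s := uIcc a₀ b₁)).absolutelyContinuousOnInterval
  -- integration by parts on both sides
  have hibp_k : ∀ k, ∫ t in a₀..b₁, β k t * g t =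
      -∫ t in a₀..b₁, (∫ s in (0 : ℝ)..t, β k s) * deriv g t := fun k =>
    integral_mul_eq_neg_integral_primitive_mul_deriv (hβm k) (hβC k) hg hga hgb
  have hibp : ∫ t in a₀..b₁, deriv B t * g t = -∫ t in a₀..b₁, B t * deriv g t := by
    have h := hBac.integral_mul_deriv_eq_deriv_mul hgac
    rw [hga, hgb, mul_zero, mul_zero, sub_self, zero_sub] at h
    rw [h, neg_neg]
  simp_rw [hibp_k, hibp]
  refine Tendsto.neg ?_
  -- dominated convergence for `∫ B_k g'`
  have hg' : ∀ t, ‖deriv g t‖ ≤ Lg := fun t => norm_deriv_le_of_lipschitz hg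
  set R : ℝ := max |a₀| |b₁| with hR
  have hBkbd : ∀ k, ∀ t ∈ uIoc a₀ b₁, ‖(∫ s in (0 : ℝ)..t, β k s) * deriv g t‖ ≤ C * R * Lg := by
    intro k t ht
    rw [norm_mul]
    have h1 : ‖∫ s in (0 : ℝ)..t, β k s‖ ≤ C * R := by
      rw [uIoc_of_le hab] at ht
      calc ‖∫ s in (0 : ℝ)..t, β k s‖ ≤ C * |t - 0| :=
            intervalIntegral.norm_integral_le_of_norm_le_const fun τ _ =>
              (Real.norm_eq_abs _).le.trans (hβC k τ)
        _ ≤ C * R := by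
            rw [sub_zero, hR]
            exact mul_le_mul_of_nonneg_left (abs_le_max_abs_abs ht.1.le ht.2) hC0
    exact mul_le_mul h1 (hg' t) (norm_nonneg _) (by positivity)
  have hmeas_g' : Measurable (deriv g) := measurable_deriv g
  refine intervalIntegral.tendsto_integral_filter_of_dominated_convergence (fun _ => C * R * Lg)
    (Eventually.of_forall fun k => ?_) (Eventually.of_forall fun k => ?_) ?_ ?_
  · exact ((hBk k).continuous.aestronglyMeasurable.mul hmeas_g'.aestronglyMeasurable)
  · exact Eventually.of_forall fun t ht => hBkbd k t ht
  · exact intervalIntegrable_const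
  · refine Eventually.of_forall fun t _ => ?_
    exact (hB t).mul tendsto_const_nhds

end Primitive

/-- **Limits of primitives are Lipschitz.** If `|β_k| ≤ C` and `∫₀ᵗ β_k → B(t)` for every `t`,
then `B` is `C`-Lipschitz. [folklore] -/
private theorem lipschitzWith_of_tendsto_primitive {β : ℕ → ℝ → ℝ} {C : ℝ} (hβm : ∀ k, Measurable (β k))
    (hβC : ∀ k t, |β k t| ≤ C) {B : ℝ → ℝ}
    (hB : ∀ t, Tendsto (fun k => ∫ s in (0 : ℝ)..t, β k s) atTop (𝓝 (B t))) :
    LipschitzWith ⟨C, (abs_nonneg _).trans (hβC 0 0)⟩ B := by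
  refine LipschitzWith.of_dist_le_mul fun t s => ?_
  refine le_of_tendsto ((hB t).dist (hB s)) (Eventually.of_forall fun k => ?_)
  exact (lipschitzWith_primitive (hβm k) (hβC k)).dist_le_mul t s

/-- **Arzelà–Ascoli for the primitives of bounded drifts.** If `|β_k| ≤ C` (measurable), then
along a subsequence the primitives `∫₀ᵗ β_k` converge for every `t` (the functions
`(1 + |t|)⁻¹ ∫₀ᵗ β_k` are uniformly bounded by `C` and uniformly `2C`-Lipschitz, so the tree's
pointwise Arzelà–Ascoli `exists_strictMono_tendsto_of_lipschitzWith` applies). [cite: Rudin1976, Thm. 7.23 and Thm. 7.25 (Arzelà–Ascoli)] -/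
theorem exists_strictMono_tendsto_primitive {β : ℕ → ℝ → ℝ} {C : ℝ}
    (hβm : ∀ k, Measurable (β k)) (hβC : ∀ k t, |β k t| ≤ C) :
    ∃ (φ : ℕ → ℕ) (B : ℝ → ℝ), StrictMono φ ∧
      ∀ t, Tendsto (fun k => ∫ s in (0 : ℝ)..t, β (φ k) s) atTop (𝓝 (B t)) := by
  have hC0 : 0 ≤ C := (abs_nonneg _).trans (hβC 0 0)
  set P : ℕ → ℝ → ℝ := fun k t => ∫ s in (0 : ℝ)..t, β k s with hP
  have hPlip : ∀ k s t, |P k t - P k s| ≤ C * |t - s| := fun k s t => by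
    have h := (lipschitzWith_primitive (hβm k) (hβC k)).dist_le_mul t s
    rw [Real.dist_eq, Real.dist_eq] at h
    exact h
  have hP0 : ∀ k, P k 0 = 0 := fun k => by simp [hP]
  have hPbd : ∀ k t, |P k t| ≤ C * |t| := fun k t => by
    have h := hPlip k 0 t
    rwa [hP0, sub_zero, sub_zero] at h
  set w : ℝ → ℝ := fun t => (1 + |t|)⁻¹ with hw
  have hw0 : ∀ t : ℝ, 0 < 1 + |t| := fun t => by positivity
  have hwle : ∀ t, w t ≤ 1 := fun t => by
    rw [hw]; exact inv_le_one_of_one_le₀ (by linarith [abs_nonneg t])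
  have hwpos : ∀ t, 0 < w t := fun t => by rw [hw]; exact inv_pos.2 (hw0 t)
  have hwdiff : ∀ s t, |w t - w s| * (1 + |s|) ≤ |t - s| := by
    intro s t
    have e : w t - w s = (|s| - |t|) / ((1 + |t|) * (1 + |s|)) := by
      rw [hw]; field_simp; ring
    rw [e, abs_div, abs_of_pos (mul_pos (hw0 t) (hw0 s)), div_mul_eq_mul_div,
      mul_comm (1 + |t|), ← div_div, mul_div_assoc, div_self (hw0 s).ne', mul_one]
    calc |(|s| - |t|)| / (1 + |t|) ≤ |(|s| - |t|)| :=
          div_le_self (abs_nonneg _) (by linarith [abs_nonneg t])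
      _ ≤ |s - t| := abs_abs_sub_abs_le_abs_sub _ _
      _ = |t - s| := abs_sub_comm _ _
  set F : ℕ → ℝ → ℝ := fun k t => P k t * w t with hF
  have hFlip : ∀ k, LipschitzWith ⟨2 * C, by positivity⟩ (F k) := by
    intro k
    refine LipschitzWith.of_dist_le_mul fun t s => ?_
    rw [Real.dist_eq, Real.dist_eq]
    change |P k t * w t - P k s * w s| ≤ 2 * C * |t - s|
    have e : P k t * w t - P k s * w s = (P k t - P k s) * w t + P k s * (w t - w s) := by ring
    rw [e]
    have h1 : |(P k t - P k s) * w t| ≤ C * |t - s| := by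
      rw [abs_mul, abs_of_pos (hwpos t)]
      calc |P k t - P k s| * w t ≤ C * |t - s| * 1 :=
            mul_le_mul (hPlip k s t) (hwle t) (hwpos t).le (by positivity)
        _ = C * |t - s| := mul_one _
    have h2 : |P k s * (w t - w s)| ≤ C * |t - s| := by
      rw [abs_mul]
      have hs1 : |s| ≤ 1 + |s| := by linarith
      calc |P k s| * |w t - w s| ≤ C * |s| * |w t - w s| :=
            mul_le_mul_of_nonneg_right (hPbd k s) (abs_nonneg _)
        _ ≤ C * ((1 + |s|) * |w t - w s|) := by
            rw [mul_assoc]; exact mul_le_mul_of_nonneg_left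
              (mul_le_mul_of_nonneg_right hs1 (abs_nonneg _)) hC0
        _ ≤ C * |t - s| := by
            refine mul_le_mul_of_nonneg_left ?_ hC0
            rw [mul_comm]; exact hwdiff s t
    calc |(P k t - P k s) * w t + P k s * (w t - w s)|
        ≤ |(P k t - P k s) * w t| + |P k s * (w t - w s)| := abs_add_le _ _
      _ ≤ C * |t - s| + C * |t - s| := add_le_add h1 h2
      _ = 2 * C * |t - s| := by ring
  have hFbd : ∀ k t, F k t ∈ closedBall (0 : ℝ) C := by
    intro k t
    rw [mem_closedBall_zero_iff, Real.norm_eq_abs]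
    change |P k t * w t| ≤ C
    rw [abs_mul, abs_of_pos (hwpos t)]
    calc |P k t| * w t ≤ C * |t| * w t := mul_le_mul_of_nonneg_right (hPbd k t) (hwpos t).le
      _ = C * (|t| * (1 + |t|)⁻¹) := by rw [hw]; ring
      _ ≤ C * 1 := by
          refine mul_le_mul_of_nonneg_left ?_ hC0
          rw [← div_eq_mul_inv, div_le_one (hw0 t)]
          linarith
      _ = C := mul_one _
  obtain ⟨φ, l, hφ, -, -, hconv⟩ := exists_strictMono_tendsto_of_lipschitzWith F hFlip hFbd
  refine ⟨φ, fun t => l t * (1 + |t|), hφ, fun t => ?_⟩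
  have h := (hconv t).mul_const (1 + |t|)
  refine h.congr fun k => ?_
  change P (φ k) t * w t * (1 + |t|) = P (φ k) t
  rw [hw, mul_assoc, inv_mul_cancel₀ (hw0 t).ne', mul_one]

/-! ### The limit theorem -/

section Limit

/-- **Pointwise bounded limits of weakly divergence-free fields are weakly divergence free**
(dominated convergence against `∇θ`). [folklore] -/
private theorem isWeaklyDivFree_of_tendsto_of_bound {V : ℕ → E → E} {v : E → E} {M : ℝ}
    (hdiv : ∀ᶠ k in atTop, IsWeaklyDivFree (V k))
    (hmeas : ∀ᶠ k in atTop, AEStronglyMeasurable (V k) volume)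
    (hbd : ∀ᶠ k in atTop, ∀ x, ‖V k x‖ ≤ M)
    (hlim : ∀ x, Tendsto (fun k => V k x) atTop (𝓝 (v x))) : IsWeaklyDivFree v := by
  intro θ hθ
  have hθ1 : ContDiff ℝ 1 θ := contDiff_infty.1 hθ.contDiff 1
  have hgc : HasCompactSupport (gradient θ) := by
    have : gradient θ = (fun L => (InnerProductSpace.toDual ℝ E).symm L) ∘ fderiv ℝ θ := rfl
    rw [this]
    exact (hθ.hasCompactSupport.fderiv (𝕜 := ℝ)).comp_left (by simp)
  have hθi : Integrable (fun x => M * ‖gradient θ x‖) volume :=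
    (((continuous_gradient_of_contDiff hθ1).integrable_of_hasCompactSupport hgc).norm).const_mul M
  have hlimθ : Tendsto (fun k => ∫ x, ⟪V k x, gradient θ x⟫) atTop
      (𝓝 (∫ x, ⟪v x, gradient θ x⟫)) := by
    refine tendsto_integral_filter_of_dominated_convergence (fun x => M * ‖gradient θ x‖)
      ?_ ?_ hθi (Eventually.of_forall fun x => (hlim x).inner tendsto_const_nhds)
    · filter_upwards [hmeas] with k hk
      exact hk.inner (continuous_gradient_of_contDiff hθ1).aestronglyMeasurable
    · filter_upwards [hbd] with k hk
      exact Eventually.of_forall fun x => (norm_inner_le_norm _ _).trans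
        (mul_le_mul_of_nonneg_right (hk x) (norm_nonneg _))
  have hzero : ∀ᶠ k in atTop, ∫ x, ⟪V k x, gradient θ x⟫ = 0 := by
    filter_upwards [hdiv] with k hk
    exact hk θ hθ
  exact tendsto_nhds_unique hlimθ (tendsto_const_nhds.congr' (hzero.mono fun k hk => hk.symm))


/-- **Limits of bounded weak solutions with parasitic drifts are bounded weak solutions, the
limit drift being the derivative of the limit of the primitives.** Let
`U_k + β_k(t) e` be bounded weak solutions of Navier–Stokes (viscosity `ν`) on `ℝⁿ × (A_k, 0)`,
`A_k → −∞`, with `U_k` continuous on its slab, `‖U_k‖ ≤ M`, weakly divergence-free slices, and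
`β_k` measurable with `|β_k| ≤ C`. Suppose `U_k(t, x) → W(t, x)` for all `t < 0`, `x`, where `W`
is jointly continuous, `‖W‖ ≤ M` and `‖W(t, x) − W(s, x)‖ ≤ L|t − s|`, and suppose the primitives
`∫₀ᵗ β_k` converge to `B(t)` for every `t`. Then `W + B'(t) e` is a bounded weak solution on
`ℝⁿ × (−∞, 0)` (`B' = deriv B`, a bounded measurable function; `B` is Lipschitz). Proof: by
`isBoundedWeakNSSolutionOn_add_smul_of_integral` it suffices to pass to the limit in the split
identities `∫∫ I[U_k] + ∫ β_k g_k = 0` (`IsBoundedWeakNSSolutionOn.integral_add_drift_eq_zero`):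
the first term by dominated convergence on the time support as in
`isBoundedWeakNSSolutionOn_of_tendsto`, `∫ β_k (g_k − g) → 0` by dominated convergence in `t`
(`g_k(t) → g(t)` by dominated convergence in `x`), and `∫ β_k g → ∫ B' g` by
`tendsto_integral_mul_of_tendsto_primitive`, `g` being Lipschitz
(`exists_lipschitz_integral_inner_of_test`). [cite: KochNadirashviliSereginSverak2009, Lemma 6.1 (p. 11) with §4 (ii) (p. 8) and §1 p. 3, arXiv:0709.3599] -/
theorem isBoundedWeakNSSolutionOn_add_smul_of_tendsto {ν M C L : ℝ} {A : ℕ → ℝ}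
    {U : ℕ → ℝ → E → E} {β : ℕ → ℝ → ℝ} {e : E} {W : ℝ → E → E} {B : ℝ → ℝ}
    (hA : Tendsto A atTop atBot)
    (hsol : ∀ k, IsBoundedWeakNSSolutionOn (Ioo (A k) 0) isOpen_Ioo ν
      (fun t x => U k t x + β k t • e))
    (hcont : ∀ k, ContinuousOn (uncurry (U k)) (Ioo (A k) 0 ×ˢ univ))
    (hbd : ∀ k, ∀ t ∈ Ioo (A k) 0, ∀ x, ‖U k t x‖ ≤ M)
    (hdivU : ∀ k, ∀ t ∈ Ioo (A k) 0, IsWeaklyDivFree (U k t))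
    (hβm : ∀ k, Measurable (β k)) (hβC : ∀ k t, |β k t| ≤ C)
    (hW : Continuous (uncurry W)) (hWM : ∀ t x, ‖W t x‖ ≤ M)
    (hWL : ∀ x s t, ‖W t x - W s x‖ ≤ L * |t - s|)
    (hlim : ∀ t < 0, ∀ x, Tendsto (fun k => U k t x) atTop (𝓝 (W t x)))
    (hB : ∀ t, Tendsto (fun k => ∫ s in (0 : ℝ)..t, β k s) atTop (𝓝 (B t))) :
    IsBoundedWeakNSSolutionOn (Iio 0) isOpen_Iio ν (fun t x => W t x + deriv B t • e) := by
  have hev : ∀ a : ℝ, ∀ᶠ k in atTop, A k < a := fun a => hA.eventually (eventually_lt_atBot a)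
  have hC0 : 0 ≤ C := (abs_nonneg _).trans (hβC 0 0)
  have hM0 : 0 ≤ M := (norm_nonneg _).trans (hWM 0 0)
  -- the limit slices are weakly divergence free
  have hWdiv : ∀ t < 0, IsWeaklyDivFree (W t) := by
    intro t ht
    refine isWeaklyDivFree_of_tendsto_of_bound (M := M) ?_ ?_ ?_ (hlim t ht)
    · filter_upwards [hev t] with k hk
      exact hdivU k t ⟨hk, ht⟩
    · filter_upwards [hev t] with k hk
      exact ((hcont k).comp_continuous (Continuous.prodMk_right t)
        fun x => ⟨⟨hk, ht⟩, mem_univ x⟩).aestronglyMeasurable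
    · filter_upwards [hev t] with k hk
      exact fun x => hbd k t ⟨hk, ht⟩ x
  -- the limit drift
  have hBlip := lipschitzWith_of_tendsto_primitive hβm hβC hB
  have hB'C : ∀ t, |deriv B t| ≤ C := fun t => by
    have h := norm_deriv_le_of_lipschitz (x₀ := t) hBlip
    rwa [Real.norm_eq_abs] at h
  have hB'm : Measurable (deriv B) := measurable_deriv B
  refine isBoundedWeakNSSolutionOn_add_smul_of_integral (I := Iio 0) (hI := isOpen_Iio)
    hW.continuousOn (fun t _ x => hWM t x) (fun t ht => hWdiv t ht) hB'm hB'C ?_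
  intro ψ hψ hψdiv
  obtain ⟨a', b, ha'b, hb0, hsupp⟩ := hψ.exists_time_support_lt
  have hψ' : IsSpaceTimeTestOn (⊤ : Opens (ℝ × E)) ψ := hψ.mono le_top
  set a₀ : ℝ := a' - 1 with ha₀
  set b₁ : ℝ := b / 2 with hb₁
  have ha₀a' : a₀ < a' := by rw [ha₀]; linarith
  have hbb₁ : b < b₁ := by rw [hb₁]; linarith
  have hb₁0 : b₁ < 0 := by rw [hb₁]; linarith
  have ha₀b₁ : a₀ ≤ b₁ := by linarith
  have hIoc_sub : Ioc a₀ b₁ ⊆ Iio (0 : ℝ) := fun t ht => ht.2.trans_lt hb₁0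
  have hout : ∀ t, t ∉ Icc a' b → ∀ x, fderiv ℝ (ψ t) x = 0 := fun t ht x => by
    rw [hsupp t ht]; exact fderiv_const_apply 0
  -- the drift test field `Φ = Dψ[e]` and the pairings
  set Φ : ℝ → E → E := fun t x => fderiv ℝ (ψ t) x e with hΦdef
  have hΦ : IsSpaceTimeTestOn (⊤ : Opens (ℝ × E)) Φ :=
    ⟨hψ'.fderiv_top.contDiff.clm_apply contDiff_const,
      hψ'.fderiv_top.hasCompactSupport.comp_left (g := fun L : E →L[ℝ] E => L e) (by simp),
      fun _ _ => trivial⟩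
  have hΦc : Continuous (uncurry Φ) := hΦ.continuous_uncurry
  have hΦout : ∀ t, t ∉ Icc a' b → ∀ x, Φ t x = 0 := fun t ht x => by
    simp [hΦdef, hout t ht x]
  set g : ℝ → ℝ := fun t => ∫ x, ⟪W t x, Φ t x⟫ with hgdef
  set gk : ℕ → ℝ → ℝ := fun k t => ∫ x, ⟪U k t x, Φ t x⟫ with hgkdef
  obtain ⟨Lg, hgLip⟩ := exists_lipschitz_integral_inner_of_test hW hWM hWL hΦ
  have hg_out : ∀ t, t ∉ Icc a' b → g t = 0 := fun t ht => by
    simp only [hgdef, hΦout t ht, inner_zero_right, integral_zero]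
  have hgk_out : ∀ k t, t ∉ Icc a' b → gk k t = 0 := fun k t ht => by
    simp only [hgkdef, hΦout t ht, inner_zero_right, integral_zero]
  have hga₀ : g a₀ = 0 := hg_out a₀ fun h => (not_le.2 ha₀a') h.1
  have hgb₁ : g b₁ = 0 := hg_out b₁ fun h => (not_le.2 hbb₁) h.2
  -- the space–time integrand, for a velocity field `w`
  set G : (ℝ → E → E) → ℝ × E → ℝ := fun w z => ⟪w z.1 z.2, timeDeriv ψ z.1 z.2⟫ +
    ⟪w z.1 z.2, convect (w z.1) (ψ z.1) z.2⟫ + ν * ⟪w z.1 z.2, Δ (ψ z.1) z.2⟫ with hG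
  have hGzero : ∀ w : ℝ → E → E, ∀ t, t ∉ Icc a' b → ∀ x, G w (t, x) = 0 := fun w t ht x =>
    weakIntegrand_eq_zero_of_notMem hsupp ht (w t) ν x
  -- reduction of the time integrals to `(a₀, b₁]`
  have hredG : ∀ (w : ℝ → E → E) (I : Set ℝ), MeasurableSet I → Ioc a₀ b₁ ⊆ I →
      ∫ t in I, ∫ x, G w (t, x) = ∫ t in Ioc a₀ b₁, ∫ x, G w (t, x) := by
    intro w I hI hsub
    refine setIntegral_eq_of_subset_of_forall_sdiff_eq_zero hI hsub fun t ht => ?_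
    have ht' : t ∉ Icc a' b := fun h' => ht.2 ⟨ha₀a'.trans_le h'.1, h'.2.trans hbb₁.le⟩
    simp only [hGzero w t ht', integral_zero]
  have hredD : ∀ (γ h : ℝ → ℝ) (I : Set ℝ), (∀ t, t ∉ Icc a' b → h t = 0) → MeasurableSet I →
      Ioc a₀ b₁ ⊆ I → ∫ t in I, γ t * h t = ∫ t in Ioc a₀ b₁, γ t * h t := by
    intro γ h I hh hI hsub
    refine setIntegral_eq_of_subset_of_forall_sdiff_eq_zero hI hsub fun t ht => ?_
    have ht' : t ∉ Icc a' b := fun h' => ht.2 ⟨ha₀a'.trans_le h'.1, h'.2.trans hbb₁.le⟩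
    rw [hh t ht', mul_zero]
  -- the identities of the `U k`, for `k` large, on `(a₀, b₁]`
  have hzero : ∀ᶠ k in atTop, (∫ t in Ioc a₀ b₁, ∫ x, G (U k) (t, x)) +
      ∫ t in Ioc a₀ b₁, β k t * gk k t = 0 := by
    filter_upwards [hev a₀] with k hk
    have hψk : IsSpaceTimeTestOn (slab E (Ioo (A k) 0) isOpen_Ioo) ψ :=
      hψ.of_time_support hsupp (hk.trans ha₀a') hb0
    have hsubk : Ioc a₀ b₁ ⊆ Ioo (A k) 0 := fun t ht => ⟨hk.trans ht.1, ht.2.trans_lt hb₁0⟩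
    have key := (hsol k).integral_add_drift_eq_zero (hcont k) (hbd k) (hdivU k) (hβm k) (hβC k)
      hψk hψdiv
    rw [hredG (U k) (Ioo (A k) 0) measurableSet_Ioo hsubk,
      hredD (β k) (gk k) (Ioo (A k) 0) (hgk_out k) measurableSet_Ioo hsubk] at key
    exact key
  -- (1) dominated convergence for the `U`-part, on `(a₀, b₁] × E`
  set π : Measure (ℝ × E) := ((volume : Measure ℝ).restrict (Ioc a₀ b₁)).prod volume with hπ
  have hπ' : π = (volume : Measure (ℝ × E)).restrict (Ioc a₀ b₁ ×ˢ univ) := by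
    rw [hπ, Measure.restrict_prod_eq_prod_univ, ← Measure.volume_eq_prod]
  have hπmem : ∀ᵐ z ∂π, z ∈ Ioc a₀ b₁ ×ˢ (univ : Set E) := by
    rw [hπ']; exact ae_restrict_mem (measurableSet_Ioc.prod MeasurableSet.univ)
  have hc1 : Continuous (uncurry (timeDeriv ψ)) := hψ'.timeDeriv_top.continuous_uncurry
  have hc2 : Continuous (uncurry fun t x => fderiv ℝ (ψ t) x) := hψ'.fderiv_top.continuous_uncurry
  have hc3 : Continuous (uncurry fun t => Δ (ψ t)) := hψ'.laplacian_top.continuous_uncurry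
  set bound : ℝ × E → ℝ := fun z => M * ‖timeDeriv ψ z.1 z.2‖ +
    M * M * ‖fderiv ℝ (ψ z.1) z.2‖ + |ν| * M * ‖Δ (ψ z.1) z.2‖ with hbound
  have hbound_int : Integrable bound π := by
    rw [hπ']
    refine Integrable.restrict ?_
    refine ((Integrable.const_mul ?_ M).add (Integrable.const_mul ?_ (M * M))).add
      (Integrable.const_mul ?_ (|ν| * M))
    · exact hc1.norm.integrable_of_hasCompactSupport hψ'.timeDeriv_top.hasCompactSupport.norm
    · exact hc2.norm.integrable_of_hasCompactSupport hψ'.fderiv_top.hasCompactSupport.norm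
    · exact hc3.norm.integrable_of_hasCompactSupport hψ'.laplacian_top.hasCompactSupport.norm
  have hmeasG : ∀ w : ℝ → E → E, AEStronglyMeasurable (uncurry w) π →
      AEStronglyMeasurable (G w) π := by
    intro w hw
    have happ := (isBoundedBilinearMap_apply (𝕜 := ℝ) (E := E) (F := E)).continuous
    have h2 : AEStronglyMeasurable (fun z : ℝ × E => fderiv ℝ (ψ z.1) z.2 (w z.1 z.2)) π :=
      happ.comp_aestronglyMeasurable (hc2.aestronglyMeasurable.prodMk hw)
    exact ((hw.inner hc1.aestronglyMeasurable).add (hw.inner h2)).add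
      ((hw.inner hc3.aestronglyMeasurable).const_mul ν)
  have hnormG : ∀ (w : E → E) (t : ℝ) (x : E), ‖w x‖ ≤ M →
      ‖G (fun _ => w) (t, x)‖ ≤ bound (t, x) := by
    intro w t x hw
    simp only [hG, hbound, Real.norm_eq_abs]
    have e1 : |⟪w x, timeDeriv ψ t x⟫| ≤ M * ‖timeDeriv ψ t x‖ :=
      (abs_real_inner_le_norm _ _).trans (mul_le_mul_of_nonneg_right hw (norm_nonneg _))
    have e2 : |⟪w x, convect w (ψ t) x⟫| ≤ M * M * ‖fderiv ℝ (ψ t) x‖ := by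
      rw [convect_apply]
      calc |⟪w x, fderiv ℝ (ψ t) x (w x)⟫| ≤ ‖w x‖ * ‖fderiv ℝ (ψ t) x (w x)‖ :=
            abs_real_inner_le_norm _ _
        _ ≤ ‖w x‖ * (‖fderiv ℝ (ψ t) x‖ * ‖w x‖) := by
            gcongr; exact ContinuousLinearMap.le_opNorm _ _
        _ ≤ M * (‖fderiv ℝ (ψ t) x‖ * M) := by gcongr
        _ = M * M * ‖fderiv ℝ (ψ t) x‖ := by ring
    have e3 : |ν * ⟪w x, Δ (ψ t) x⟫| ≤ |ν| * M * ‖Δ (ψ t) x‖ := by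
      rw [abs_mul, mul_assoc]
      exact mul_le_mul_of_nonneg_left ((abs_real_inner_le_norm _ _).trans
        (mul_le_mul_of_nonneg_right hw (norm_nonneg _))) (abs_nonneg ν)
    calc |⟪w x, timeDeriv ψ t x⟫ + ⟪w x, convect w (ψ t) x⟫ + ν * ⟪w x, Δ (ψ t) x⟫|
        ≤ |⟪w x, timeDeriv ψ t x⟫| + |⟪w x, convect w (ψ t) x⟫| + |ν * ⟪w x, Δ (ψ t) x⟫| :=
          (abs_add_le _ _).trans (add_le_add (abs_add_le _ _) le_rfl)
      _ ≤ _ := add_le_add (add_le_add e1 e2) e3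
  have hUmeas : ∀ᶠ k in atTop, AEStronglyMeasurable (uncurry (U k)) π := by
    filter_upwards [hev a₀] with k hk
    rw [hπ']
    exact ((hcont k).mono (prod_mono (fun t ht => ⟨hk.trans ht.1, ht.2.trans_lt hb₁0⟩)
      Subset.rfl)).aestronglyMeasurable (measurableSet_Ioc.prod MeasurableSet.univ)
  have hVmeas : ∀ᶠ k in atTop, AEStronglyMeasurable (G (U k)) π := by
    filter_upwards [hUmeas] with k hk
    exact hmeasG (U k) hk
  have hVbound : ∀ᶠ k in atTop, ∀ᵐ z ∂π, ‖G (U k) z‖ ≤ bound z := by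
    filter_upwards [hev a₀] with k hk
    filter_upwards [hπmem] with z hz
    exact hnormG (U k z.1) z.1 z.2 (hbd k z.1 ⟨hk.trans hz.1.1, hz.1.2.trans_lt hb₁0⟩ z.2)
  have hWmeasπ : AEStronglyMeasurable (uncurry W) π := hW.aestronglyMeasurable
  have hvmeas : AEStronglyMeasurable (G W) π := hmeasG W hWmeasπ
  have hvbound : ∀ᵐ z ∂π, ‖G W z‖ ≤ bound z :=
    Eventually.of_forall fun z => hnormG (W z.1) z.1 z.2 (hWM z.1 z.2)
  have hGlim : ∀ᵐ z ∂π, Tendsto (fun k => G (U k) z) atTop (𝓝 (G W z)) := by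
    filter_upwards [hπmem] with z hz
    have hl := hlim z.1 (hz.1.2.trans_lt hb₁0) z.2
    simp only [hG, convect_apply]
    exact ((hl.inner tendsto_const_nhds).add
      (hl.inner (((fderiv ℝ (ψ z.1) z.2).continuous.tendsto _).comp hl))).add
      ((hl.inner tendsto_const_nhds).const_mul ν)
  have hDCT : Tendsto (fun k => ∫ z, G (U k) z ∂π) atTop (𝓝 (∫ z, G W z ∂π)) :=
    tendsto_integral_filter_of_dominated_convergence bound hVmeas hVbound hbound_int hGlim
  have hiter : ∀ w : ℝ → E → E, AEStronglyMeasurable (G w) π → (∀ᵐ z ∂π, ‖G w z‖ ≤ bound z) →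
      ∫ z, G w z ∂π = ∫ t in Ioc a₀ b₁, ∫ x, G w (t, x) := by
    intro w hw hwb
    have hint : Integrable (G w) π := hbound_int.mono' hw hwb
    rw [hπ] at hint
    rw [hπ, integral_prod _ hint]
  have hX : Tendsto (fun k => ∫ t in Ioc a₀ b₁, ∫ x, G (U k) (t, x)) atTop
      (𝓝 (∫ t in Ioc a₀ b₁, ∫ x, G W (t, x))) := by
    rw [← hiter W hvmeas hvbound]
    refine hDCT.congr' ?_
    filter_upwards [hVmeas, hVbound] with k h1 h2
    exact hiter (U k) h1 h2
  -- (2) the drift part: `∫ β_k (g_k − g) → 0`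
  have hΦsl : ∀ t, Continuous (Φ t) := fun t => (hΦ.contDiff_slice t).continuous
  have hΦcs : ∀ t, HasCompactSupport (Φ t) := fun t => hΦ.hasCompactSupport_slice t
  have hNint : ∀ t, Integrable (fun x => M * ‖Φ t x‖) (volume : Measure E) := fun t =>
    ((hΦsl t).norm.integrable_of_hasCompactSupport (hΦcs t).norm).const_mul M
  -- pointwise convergence `g_k(t) → g(t)` for `t < 0`
  have hgk_lim : ∀ t < 0, Tendsto (fun k => gk k t) atTop (𝓝 (g t)) := by
    intro t ht
    refine tendsto_integral_filter_of_dominated_convergence (fun x => M * ‖Φ t x‖) ?_ ?_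
      (hNint t) (Eventually.of_forall fun x => (hlim t ht x).inner tendsto_const_nhds)
    · filter_upwards [hev t] with k hk
      have hsl : Continuous (U k t) :=
        (hcont k).comp_continuous (Continuous.prodMk_right t) fun x => ⟨⟨hk, ht⟩, mem_univ x⟩
      exact (hsl.inner (hΦsl t)).aestronglyMeasurable
    · filter_upwards [hev t] with k hk
      exact Eventually.of_forall fun x => (norm_inner_le_norm _ _).trans
        (mul_le_mul_of_nonneg_right (hbd k t ⟨hk, ht⟩ x) (norm_nonneg _))
  -- bounds `|g_k(t)|, |g(t)| ≤ M ∫ ‖Φ(t, ·)‖`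
  have hgk_bd : ∀ᶠ k in atTop, ∀ t ∈ Ioc a₀ b₁, |gk k t| ≤ ∫ x, M * ‖Φ t x‖ := by
    filter_upwards [hev a₀] with k hk t ht
    rw [← Real.norm_eq_abs]
    exact norm_integral_le_of_norm_le (hNint t) (Eventually.of_forall fun x =>
      (norm_inner_le_norm _ _).trans (mul_le_mul_of_nonneg_right
        (hbd k t ⟨hk.trans ht.1, ht.2.trans_lt hb₁0⟩ x) (norm_nonneg _)))
  have hg_bd : ∀ t, |g t| ≤ ∫ x, M * ‖Φ t x‖ := fun t => by
    rw [← Real.norm_eq_abs]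
    exact norm_integral_le_of_norm_le (hNint t) (Eventually.of_forall fun x =>
      (norm_inner_le_norm _ _).trans (mul_le_mul_of_nonneg_right (hWM t x) (norm_nonneg _)))
  -- integrability in `t` of `t ↦ ∫ M ‖Φ(t, x)‖ dx` on `(a₀, b₁]`, through the product
  have hNprod : Integrable (fun z : ℝ × E => M * ‖Φ z.1 z.2‖) π := by
    rw [hπ']
    exact ((hΦc.norm.integrable_of_hasCompactSupport hΦ.hasCompactSupport.norm).const_mul M).restrict
  have hNt : Integrable (fun t => ∫ x, M * ‖Φ t x‖) ((volume : Measure ℝ).restrict (Ioc a₀ b₁)) :=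
    hNprod.integral_prod_left
  -- measurability of `g_k` on `(a₀, b₁]`, through the product
  have hgk_meas : ∀ᶠ k in atTop,
      AEStronglyMeasurable (gk k) ((volume : Measure ℝ).restrict (Ioc a₀ b₁)) := by
    filter_upwards [hUmeas, hev a₀] with k hk hk'
    have hH : Integrable (fun z : ℝ × E => ⟪U k z.1 z.2, Φ z.1 z.2⟫) π := by
      refine hNprod.mono' (hk.inner hΦc.aestronglyMeasurable) ?_
      filter_upwards [hπmem] with z hz
      exact (norm_inner_le_norm _ _).trans (mul_le_mul_of_nonneg_right
        (hbd k z.1 ⟨hk'.trans hz.1.1, hz.1.2.trans_lt hb₁0⟩ z.2) (norm_nonneg _))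
    exact hH.integral_prod_left.aestronglyMeasurable
  have hY1 : Tendsto (fun k => ∫ t in Ioc a₀ b₁, β k t * (gk k t - g t)) atTop (𝓝 0) := by
    have h0 : (0 : ℝ) = ∫ t in Ioc a₀ b₁, (0 : ℝ) := by simp
    rw [h0]
    refine tendsto_integral_filter_of_dominated_convergence
      (fun t => C * ((∫ x, M * ‖Φ t x‖) + ∫ x, M * ‖Φ t x‖)) ?_ ?_
      ((hNt.add hNt).const_mul C) ?_
    · filter_upwards [hgk_meas] with k hk
      exact ((hβm k).aestronglyMeasurable.mul (hk.sub hgLip.continuous.aestronglyMeasurable))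
    · filter_upwards [hgk_bd] with k hk
      filter_upwards [ae_restrict_mem measurableSet_Ioc] with t ht
      rw [norm_mul, Real.norm_eq_abs, Real.norm_eq_abs]
      refine mul_le_mul (hβC k t) ?_ (abs_nonneg _) hC0
      exact (abs_sub _ _).trans (add_le_add (hk t ht) (hg_bd t))
    · filter_upwards [ae_restrict_mem measurableSet_Ioc] with t ht
      have hd : Tendsto (fun k => gk k t - g t) atTop (𝓝 0) := by
        have := (hgk_lim t (hIoc_sub ht)).sub_const (g t)
        rwa [sub_self] at this
      refine squeeze_zero_norm (fun k => ?_) ((hd.norm.const_mul C).trans_eq (by simp))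
      rw [norm_mul, Real.norm_eq_abs]
      exact mul_le_mul_of_nonneg_right (hβC k t) (norm_nonneg _)
  -- (3) the drift part: `∫ β_k g → ∫ B' g`
  have hY2 : Tendsto (fun k => ∫ t in Ioc a₀ b₁, β k t * g t) atTop
      (𝓝 (∫ t in Ioc a₀ b₁, deriv B t * g t)) := by
    have h := tendsto_integral_mul_of_tendsto_primitive hβm hβC hB hgLip ha₀b₁ hga₀ hgb₁
    simp only [intervalIntegral.integral_of_le ha₀b₁] at h
    exact h
  have hY : Tendsto (fun k => ∫ t in Ioc a₀ b₁, β k t * gk k t) atTop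
      (𝓝 (∫ t in Ioc a₀ b₁, deriv B t * g t)) := by
    have hsum : ∀ᶠ k in atTop, ∫ t in Ioc a₀ b₁, β k t * gk k t =
        (∫ t in Ioc a₀ b₁, β k t * (gk k t - g t)) + ∫ t in Ioc a₀ b₁, β k t * g t := by
      filter_upwards [hgk_meas, hgk_bd] with k hk hkb
      have hi1 : Integrable (fun t => β k t * (gk k t - g t))
          ((volume : Measure ℝ).restrict (Ioc a₀ b₁)) := by
        refine (((hNt.add hNt).const_mul C)).mono'
          ((hβm k).aestronglyMeasurable.mul (hk.sub hgLip.continuous.aestronglyMeasurable)) ?_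
        filter_upwards [ae_restrict_mem measurableSet_Ioc] with t ht
        rw [norm_mul, Real.norm_eq_abs, Real.norm_eq_abs]
        refine mul_le_mul (hβC k t) ?_ (abs_nonneg _) hC0
        exact (abs_sub _ _).trans (add_le_add (hkb t ht) (hg_bd t))
      have hi2 : Integrable (fun t => β k t * g t) ((volume : Measure ℝ).restrict (Ioc a₀ b₁)) := by
        refine ((hNt.const_mul C)).mono'
          ((hβm k).aestronglyMeasurable.mul hgLip.continuous.aestronglyMeasurable) ?_
        refine Eventually.of_forall fun t => ?_
        rw [norm_mul, Real.norm_eq_abs, Real.norm_eq_abs]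
        exact mul_le_mul (hβC k t) (hg_bd t) (abs_nonneg _) hC0
      rw [← integral_add hi1 hi2]
      refine integral_congr_ae (Eventually.of_forall fun t => ?_)
      ring
    have := hY1.add hY2
    rw [zero_add] at this
    exact this.congr' (hsum.mono fun k hk => hk.symm)
  -- conclusion
  have hlim0 : (∫ t in Ioc a₀ b₁, ∫ x, G W (t, x)) + ∫ t in Ioc a₀ b₁, deriv B t * g t = 0 :=
    tendsto_nhds_unique (hX.add hY) (tendsto_const_nhds.congr' (hzero.mono fun k hk => hk.symm))
  have hfinG := hredG W (Iio 0) measurableSet_Iio hIoc_sub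
  have hfinD := hredD (deriv B) g (Iio 0) hg_out measurableSet_Iio hIoc_sub
  simp only [hG] at hfinG hlim0
  rw [hfinG, hfinD]
  exact hlim0

end Limit

end Literature.Analysis.FluidPDE

end
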